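import Summits.ValiantsHypothesis.ValiantsHypothesis.Theses.BorderApolarity
import Summits.ValiantsHypothesis.ValiantsHypothesis.Theorems.BorderApolarityFixedWitnessObstructionQPAnnSubmodule
import Summits.ValiantsHypothesis.ValiantsHypothesis.Theorems.BorderApolarityFixedWitnessObstructionQPKuratowskiSubmodule
import Literature.Computability.AlgebraicComplexity.Apolarity

/-!
# `ToricFixedPoints` — negative lemma: the upper Kuratowski clause (Ls) is load-bearing

Crux `Summit.ValiantsHypothesis.ValiantsHypothesis.Theses.BorderApolarity.ToricFixedPoints`
(stmt-ValiantsHypothesis-5779).  `ToricFixedPointsWithoutUpperLimit` is the crux with the hypothesis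
clause (Ls) `∀ k ≤ m, ∀ D φ Ds, StrictMono φ → (∀ t, Ds t ∈ Ann_k(P (φ t))) → Ds → D → D ∈ J k` deleted
(text otherwise verbatim); `toricFixedPoints_false_without_upperLimit` proves it is false: witness
`n = m = 3`, `P_t = det_3`, `J_k = {0}` — the remaining hypotheses hold trivially, while the conclusion's
own clause (Ls') would make `J_3 = {0}` the Kuratowski limit of the `164`-dimensional annihilators
`Ann_3(Q_t)` (`stub_annSubmodule`: `dim Ann_3 = C(11,3) - C(3,3)²` on the orbit), which is
`164`-dimensional by closedness of the Grassmannian (`stub_kuratowskiSubmodule`).  Moral for provers: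
(Ls) is the ONLY hypothesis bounding `dim J_k` from below; every proof must use both halves of the
Kuratowski limit.  Refuter cdisprove unit, cycle 2 (`Cruxes/ToricFixedPoints/Disproof.lean` §3).
[folklore]
-/

namespace Summit.ValiantsHypothesis.Cruxes.ToricFixedPoints.Negative


open Literature.Computability.AlgebraicComplexity
open Summit.ValiantsHypothesis.ValiantsHypothesis.Theorems.BorderApolarityFixedWitnessObstructionQP
open scoped BigOperators Matrix
open Filter MvPolynomial

/-- The crux with the clause (Ls) `∀ k ≤ m, ∀ D φ Ds, StrictMono φ → … → D ∈ J k` DELETED from the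
hypotheses (text otherwise verbatim). -/
def ToricFixedPointsWithoutUpperLimit : Prop :=
  ∀ (n m : ℕ) [NeZero m], 3 ≤ n → n ≤ m → let act := fun (D f : MvPolynomial (Fin m × Fin m) ℂ) => ∑ e ∈ D.support, ∑ d ∈ f.support, MvPolynomial.monomial (d - e) (MvPolynomial.coeff e D * MvPolynomial.coeff d f * ∏ i ∈ e.support, (Nat.descFactorial (d i) (e i) : ℂ)); let rk := fun (p : Fin m × Fin m) => (if (m - n ≤ (p.1 : ℕ) ∧ m - n ≤ (p.2 : ℕ)) ∨ p = (0, 0) then 0 else m * m) + ((p.1 : ℕ) * m + (p.2 : ℕ)); ∀ (P : ℕ → MvPolynomial (Fin m × Fin m) ℂ) (J : ℕ → Set (MvPolynomial (Fin m × Fin m) ℂ)), (∀ t : ℕ, P t ∈ Literature.Computability.AlgebraicComplexity.glOrbit (Fin m × Fin m) ℂ (Literature.Computability.AlgebraicComplexity.detPoly (Fin m) ℂ)) → (∀ k ≤ m, ∀ D ∈ J k, ∃ Ds : ℕ → MvPolynomial (Fin m × Fin m) ℂ, (∀ t, (Ds t).IsHomogeneous k ∧ act (Ds t) (P t) = 0)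 ∧ Filter.Tendsto (fun t => Literature.Computability.AlgebraicComplexity.coeffVec (Ds t)) Filter.atTop (nhds (Literature.Computability.AlgebraicComplexity.coeffVec D))) → (∀ A : Matrix.GeneralLinearGroup (Fin m × Fin m) ℂ, let M : Matrix (Fin m × Fin m) (Fin m × Fin m) ℂ := A; (∀ i j : Fin m × Fin m, M j i ≠ 0 → rk j ≤ rk i) → (∀ i j : Fin m × Fin m, ((m - n ≤ (i.1 : ℕ) ∧ m - n ≤ (i.2 : ℕ)) ∨ i = (0, 0)) → j ≠ i → M j i = 0) → (∀ i k j l : Fin m, m - n ≤ (i : ℕ) → m - n ≤ (k : ℕ) → m - n ≤ (j : ℕ) → m - n ≤ (l : ℕ) → M (i, j) (i, j) * M (k, l) (k, l) = M (i, l) (i, l) * M (k, j) (k, j)) → M (0, 0) (0, 0) ^ (m - n) * ∏ i ∈ Finset.univ.filter (fun i : Fin m => m - n ≤ (i : ℕ)), M (i, i) (i, i) = 1 → ∀ k ≤ m, ∀ D ∈ J k, Literature.Computability.AlgebraicComplexity.linSubst (Fin m × Fin m) ℂ Mᵀ D ∈ J k) → ∃ (u g : Matrix.GeneralLinearGroup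 (Fin m × Fin m) ℂ) (w : Fin m × Fin m → ℤ), let Q : ℕ → MvPolynomial (Fin m × Fin m) ℂ := fun t => Literature.Computability.AlgebraicComplexity.linSubst (Fin m × Fin m) ℂ (u : Matrix (Fin m × Fin m) (Fin m × Fin m) ℂ) (Literature.Computability.AlgebraicComplexity.linSubst (Fin m × Fin m) ℂ (Matrix.diagonal fun i : Fin m × Fin m => ((t : ℂ) + 2) ^ (w i)) (Literature.Computability.AlgebraicComplexity.linSubst (Fin m × Fin m) ℂ (g : Matrix (Fin m × Fin m) (Fin m × Fin m) ℂ) (Literature.Computability.AlgebraicComplexity.detPoly (Fin m) ℂ))); (∀ k ≤ m, ∀ D ∈ J k, ∃ Ds : ℕ → MvPolynomial (Fin m × Fin m) ℂ, (∀ t, (Ds t).IsHomogeneous k ∧ act (Ds t) (Q t) = 0) ∧ Filter.Tendsto (fun t => Literature.Computability.AlgebraicComplexity.coeffVec (Ds t)) Filter.atTop (nhds (Literature.Computability.AlgebraicComplexity.coeffVec D))) ∧ (∀ k ≤ m, ∀ (D : MvPolynomial (Fin m × Fin m) ℂ) (φ : ℕ → ℕ) (Ds : ℕ → MvPolynomial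 (Fin m × Fin m) ℂ), StrictMono φ → (∀ t, (Ds t).IsHomogeneous k ∧ act (Ds t) (Q (φ t)) = 0) → Filter.Tendsto (fun t => Literature.Computability.AlgebraicComplexity.coeffVec (Ds t)) Filter.atTop (nhds (Literature.Computability.AlgebraicComplexity.coeffVec D)) → D ∈ J k)

/-- The crux's toric curve stays in the orbit `GL·det_m`. [folklore] -/
theorem toricCurve_mem_glOrbit {m : ℕ} (u g : Matrix.GeneralLinearGroup (Fin m × Fin m) ℂ)
    (w : Fin m × Fin m → ℤ) (t : ℕ) :
    linSubst (Fin m × Fin m) ℂ (u : Matrix (Fin m × Fin m) (Fin m × Fin m) ℂ)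
      (linSubst (Fin m × Fin m) ℂ (Matrix.diagonal fun i : Fin m × Fin m => ((t : ℂ) + 2) ^ (w i))
        (linSubst (Fin m × Fin m) ℂ (g : Matrix (Fin m × Fin m) (Fin m × Fin m) ℂ) (detPoly (Fin m) ℂ)))
      ∈ glOrbit (Fin m × Fin m) ℂ (detPoly (Fin m) ℂ) := by
  have ht2 : ((t : ℂ) + 2) ≠ 0 := by
    have : (0 : ℝ) < (t : ℝ) + 2 := by positivity
    exact_mod_cast this.ne'
  have hdet : (Matrix.diagonal fun i : Fin m × Fin m => ((t : ℂ) + 2) ^ (w i)).det ≠ 0 := by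
    rw [Matrix.det_diagonal]
    exact Finset.prod_ne_zero_iff.mpr fun i _ => zpow_ne_zero _ ht2
  refine ⟨u * Matrix.GeneralLinearGroup.mkOfDetNeZero _ hdet * g, ?_⟩
  show linSubst (Fin m × Fin m) ℂ
      ((u * Matrix.GeneralLinearGroup.mkOfDetNeZero _ hdet * g : Matrix.GeneralLinearGroup (Fin m × Fin m) ℂ) :
        Matrix (Fin m × Fin m) (Fin m × Fin m) ℂ) (detPoly (Fin m) ℂ) = _
  rw [Units.val_mul, Units.val_mul, linSubst_mul, linSubst_mul]
  rfl

/-- `ToricFixedPointsWithoutUpperLimit` is FALSE — witness `n = m = 3`, `P_t = det_3`, `J_k = {0}`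
(every remaining hypothesis holds trivially); the conclusion's clause (Ls') would make `J_3` the
Kuratowski limit of the `164`-dimensional spaces `Ann_3(Q_t)` (`stub_annSubmodule`: `dim Ann_3 =
C(11,3) - 1`), hence `164`-dimensional by closedness of the Grassmannian (`stub_kuratowskiSubmodule`),
not `{0}`.  Hence clause (Ls) of the crux is load-bearing: it is the only hypothesis bounding `J_k`
from below. [folklore] -/
theorem toricFixedPoints_false_without_upperLimit : ¬ ToricFixedPointsWithoutUpperLimit := by
  intro h
  have h3 := @h 3 3 inferInstance le_rfl le_rfl
  dsimp only at h3
  refine absurd (h3 (fun _ => detPoly (Fin 3) ℂ) (fun _ => {0})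
    (fun _ => mem_glOrbit_self _) ?_ ?_) ?_
  · -- (Li) for J = {0}
    intro k _hk D hD
    have hD0 : D = 0 := hD
    subst hD0
    refine ⟨fun _ => 0, fun t => ⟨isHomogeneous_zero _ _ _, ?_⟩, tendsto_const_nhds⟩
    simp [MvPolynomial.support_zero]
  · -- H₀-stability of {0}
    intro A _h1 _h2 _h3 _h4 k _hk D hD
    have hD0 : D = 0 := hD
    show linSubst (Fin 3 × Fin 3) ℂ (A : Matrix (Fin 3 × Fin 3) (Fin 3 × Fin 3) ℂ)ᵀ D = 0
    rw [hD0, map_zero]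
  · -- the conclusion fails: J 3 would have dimension 164
    rintro ⟨u, g, w, -, hLs'⟩
    -- the annihilator subspaces along the toric curve
    have hA : ∀ t : ℕ, ∃ A : Submodule ℂ (MvPolynomial (Fin 3 × Fin 3) ℂ),
        (A : Set (MvPolynomial (Fin 3 × Fin 3) ℂ)) = annihilatorOfDegree
          (linSubst (Fin 3 × Fin 3) ℂ (u : Matrix (Fin 3 × Fin 3) (Fin 3 × Fin 3) ℂ)
            (linSubst (Fin 3 × Fin 3) ℂ (Matrix.diagonal fun i : Fin 3 × Fin 3 => ((t : ℂ) + 2) ^ (w i))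
              (linSubst (Fin 3 × Fin 3) ℂ (g : Matrix (Fin 3 × Fin 3) (Fin 3 × Fin 3) ℂ) (detPoly (Fin 3) ℂ)))) 3 ∧
        A ≤ MvPolynomial.homogeneousSubmodule (Fin 3 × Fin 3) ℂ 3 ∧
        Module.finrank ℂ A = Nat.choose (3 * 3 + 3 - 1) 3 - (Nat.choose 3 3) ^ 2 :=
      fun t => stub_annSubmodule 3 3 _ (toricCurve_mem_glOrbit u g w t)
    choose A hAeq hAle hAdim using hA
    have hdim : ∀ t, Module.finrank ℂ (A t) = 164 := by
      intro t; rw [hAdim t]; decide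
    obtain ⟨Lk, hLk, -, hLkdim⟩ := stub_kuratowskiSubmodule (σ := Fin 3 × Fin 3) 3 164 A
      ({0} : Set (MvPolynomial (Fin 3 × Fin 3) ℂ)) hAle hdim
      (by
        intro D hD
        have hD0 : D = 0 := hD
        subst hD0
        exact ⟨fun _ => 0, fun t => Submodule.zero_mem _, tendsto_const_nhds⟩)
      (by
        intro D φ Ds hφ hDs hlim
        refine hLs' 3 le_rfl D φ Ds hφ (fun t => ?_) hlim
        have hmem : Ds t ∈ (A (φ t) : Set (MvPolynomial (Fin 3 × Fin 3) ℂ)) := hDs t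
        rw [hAeq (φ t), mem_annihilatorOfDegree_iff] at hmem
        exact hmem)
    have hbot : Lk = ⊥ := by
      refine le_antisymm (fun D hD => ?_) bot_le
      have hD' : D ∈ (Lk : Set (MvPolynomial (Fin 3 × Fin 3) ℂ)) := hD
      rw [hLk] at hD'
      have hD0 : D = 0 := hD'
      rw [hD0]
      exact Submodule.zero_mem _
    rw [hbot, finrank_bot] at hLkdim
    exact absurd hLkdim (by decide)

end Summit.ValiantsHypothesis.Cruxes.ToricFixedPoints.Negative
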